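import Mathlib
import HarnessLib

/-!
# Baxterisation of the Temperley–Lieb algebra: Ikhlef–Ponsaing's `Ř`-matrix, Yang–Baxter, unitarity

Topic `Literature/Probability/LatticeModels`. Ikhlef–Ponsaing (J. Stat. Phys. 149 (2012),
arXiv:1202.5476) §3.2: with `[z] := z - 1/z`, loop weight `n = -(q + q⁻¹)` and the
Temperley–Lieb generators `e_j`, the operator of Def. 3.2 is
`Ř_j(w) = ([q/w]/[qw]) 1 - ([w]/[qw]) e_j`; Lemma 3.1 states that the `R`-matrix satisfies the
Yang–Baxter equation, the unitarity relation and the crossing relation. This file proves the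
ALGEBRAIC content of Lemma 3.1 in ANY algebra containing elements with the Temperley–Lieb relations
(so that it applies verbatim to every representation — link patterns, spin chain, connectivity
basis):

* `qbr x = x - x⁻¹` (`[x]`), `tlRnum q w e = [q/w]·1 - [w]·e` — the numerator `[qw] Ř_j(w)`;
* **`tlRnum_yangBaxter`** — `Ř₁(u) Ř₂(uv) Ř₁(v) = Ř₂(v) Ř₁(uv) Ř₂(u)` (numerator form; the scalar
  denominators `[qu][quv][qv]` agree on both sides) from `e₁² = n e₁`, `e₂² = n e₂`,
  `e₁e₂e₁ = e₁`, `e₂e₁e₂ = e₂`;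
* **`tlRnum_unitarity`** — `Ř(w) Ř(1/w) = 1`, i.e. `[qw]Ř(w) · [q/w]Ř(1/w) = [q/w][qw]·1`;
* `tlRnum_comm` — distant `Ř`'s commute.

(The crossing relation of Lemma 3.1 is a statement about the diagrammatic `R`-matrix of Def. 3.1,
a `90°` rotation exchanging the two tiles and `w ↔ q/w`; in the algebra it is the definition of
`Ř` read sideways and has no separate algebraic content.)

## References

* Y. Ikhlef, A. K. Ponsaing, J. Stat. Phys. 149 (2012) 10–36, arXiv:1202.5476, §3.2, Defs. 3.1,
  3.2, Lemma 3.1. [IkhlefPonsaing2012]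
* V. F. R. Jones, Baxterization, Int. J. Mod. Phys. B 4 (1990) 701–713 (the general mechanism).
-/

namespace Literature.Probability.LatticeModels.TemperleyLieb

variable {K : Type*} [Field K] {A : Type*} [Ring A] [Algebra K A]

/-- IP12's bracket `[x] := x - 1/x`. [cite: IkhlefPonsaing2012, Def. 3.1] -/
def qbr (x : K) : K := x - x⁻¹

/-- `[1/x] = -[x]`. [folklore] -/
theorem qbr_inv (x : K) : qbr x⁻¹ = -qbr x := by
  simp [qbr]

/-- `[1] = 0`. [folklore] -/
theorem qbr_one : qbr (1 : K) = 0 := by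
  simp [qbr]

/-- **IP12's `Ř`-operator, numerator form**: `[qw] Ř_j(w) = [q/w]·1 - [w]·e_j` for a Temperley–Lieb
generator `e_j` (Def. 3.2: `Ř_j(w) := ([q/w]/[qw]) 1 - ([w]/[qw]) e_j`). [cite: IkhlefPonsaing2012, Def. 3.2] -/
def tlRnum (q w : K) (e : A) : A := algebraMap K A (qbr (q / w)) - qbr w • e

/-- Distant `Ř`'s commute (from `e e' = e' e`). [cite: IkhlefPonsaing2012, §3.2] -/
theorem tlRnum_comm (q u v : K) {e e' : A} (h : e * e' = e' * e) :
    tlRnum q u e * tlRnum q v e' = tlRnum q v e' * tlRnum q u e := by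
  simp only [tlRnum, Algebra.algebraMap_eq_smul_one, mul_sub, sub_mul, smul_mul_assoc,
    mul_smul_comm, mul_one, one_mul, h]
  module

/-- **Yang–Baxter equation** (IP12 Lemma 3.1, eq. (YBE)), in braid form for the Baxterised
Temperley–Lieb generators: `Ř₁(u) Ř₂(uv) Ř₁(v) = Ř₂(v) Ř₁(uv) Ř₂(u)` whenever
`e₁² = -(q+q⁻¹) e₁`, `e₂² = -(q+q⁻¹) e₂`, `e₁ e₂ e₁ = e₁`, `e₂ e₁ e₂ = e₂` (numerators; the
denominators `[qu] [quv] [qv]` are the same scalar on both sides). [cite: IkhlefPonsaing2012, Lemma 3.1] -/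
theorem tlRnum_yangBaxter {q u v : K} (hq : q ≠ 0) (hu : u ≠ 0) (hv : v ≠ 0) {e₁ e₂ : A}
    (h11 : e₁ * e₁ = (-(q + q⁻¹)) • e₁) (h22 : e₂ * e₂ = (-(q + q⁻¹)) • e₂)
    (h121 : e₁ * e₂ * e₁ = e₁) (h212 : e₂ * e₁ * e₂ = e₂) :
    tlRnum q u e₁ * tlRnum q (u * v) e₂ * tlRnum q v e₁ =
      tlRnum q v e₂ * tlRnum q (u * v) e₁ * tlRnum q u e₂ := by
  simp only [tlRnum, Algebra.algebraMap_eq_smul_one, mul_sub, sub_mul, smul_mul_assoc,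
    mul_smul_comm, smul_smul, mul_one, one_mul, ← mul_assoc, h11, h22, h121, h212, smul_sub,
    qbr]
  match_scalars <;> field_simp
  all_goals ring

/-- **Unitarity** (IP12 Lemma 3.1, eq. (unitarity)): `Ř(w) Ř(1/w) = 1`, i.e. in numerator form
`([q/w] - [w] e) ([qw] - [1/w] e) = [q/w][qw]·1` whenever `e² = -(q+q⁻¹) e`. [cite: IkhlefPonsaing2012, Lemma 3.1] -/
theorem tlRnum_unitarity {q w : K} (hq : q ≠ 0) (hw : w ≠ 0) {e : A}
    (h : e * e = (-(q + q⁻¹)) • e) :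
    tlRnum q w e * tlRnum q w⁻¹ e = algebraMap K A (qbr (q / w) * qbr (q * w)) := by
  simp only [tlRnum, Algebra.algebraMap_eq_smul_one, mul_sub, sub_mul, smul_mul_assoc,
    mul_smul_comm, smul_smul, mul_one, one_mul, h, smul_sub, qbr, div_inv_eq_mul, inv_inv]
  match_scalars <;> field_simp
  ring

/-- The value at `w = 1`: `[q] Ř(1) = [q]·1` (the identity tile), used at the homogeneous point. [folklore] -/
theorem tlRnum_one (q : K) (e : A) : tlRnum q 1 e = algebraMap K A (qbr q) := by
  simp [tlRnum, qbr_one]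

/-- The value at `w = q`: `Ř(q)`'s numerator is `-[q] e` (a pure Temperley–Lieb generator: the point
`z_{i+1} = q z_i` of the recursions of IP12 §3.3–3.4). [cite: IkhlefPonsaing2012, Lemma 3.3] -/
theorem tlRnum_self {q : K} (hq : q ≠ 0) (e : A) : tlRnum q q e = -(qbr q • e) := by
  simp [tlRnum, qbr, div_self hq]

end Literature.Probability.LatticeModels.TemperleyLieb
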